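import Summits.CriticalPhenomena.PercolationContinuityZ3.Theorems.Transplant.SiteSamePContinuation
import Summits.CriticalPhenomena.PercolationContinuityZ3.Theorems.Transplant.StatementSite
import Literature.Probability.LatticeModels.LatticeGraph
import HarnessLib

/-!
# SITE percolation on `ℤ^d`: the V18 socket of class C1a — the site same-`p` witness at the origin (site KN §4, to be constructed) implies
# `θ^{site}_{ℤ^d}(p_c^{site}) = 0`; at `d = 3` the lane target `SitePercolationContinuityZ3` (lane `prim-bschramm`, seat p1 gen 2)

builds on p205010 (kernel theorem, internal audit signed; external expert review pending).

After today's landings the site chain for class C1a reads: finite leg ✓ (`SiteCSH.siteNearOneGluing_holds`, p215077), site uniqueness S1 ✓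
(p210918), SITE THEOREM A ✓ (`SiteSameP.siteTheta_criticalProb_eq_zero_of_schemes`, prim-hp-8, star-graph encoding).  This file names the ONE
remaining input in the exact shape Theorem A consumes and closes the target from it:
* `SiteSamePWitnessZd d` — INPUT (FSW)-site for `ℤ^d` at the origin, with the star `⊤` on `Option (Site d)` as carrier: at every density with
  `θ^{site}_0(p) > 0` a bounded-range history-driven scheme, lawful with `ε < 2⁻³²`, whose infinite macro-cluster forces `0 ↔^{site} ∞`
  (to be produced by the SITE re-typing of Kozma–Nitzan §4 from `siteNearOneGluing_holds` + S1 + the box geometry of `ℤ^d`, `d ≥ 3`);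
* **`sitePercolationContinuity_of_siteSamePWitnessZd`** : `SiteSamePWitnessZd d → SitePercolationContinuity d` (every `d`);
* **`sitePercolationContinuityZ3_of_siteSamePWitnessZd`** : `SiteSamePWitnessZd 3 → SitePercolationContinuityZ3`.
Definitions + proofs (`--supports stmt-CriticalPhenomena-4575 --as helper`); one `Prop`-valued predicate of `d` (the socket), no named facts, no sorries.
[cite: KozmaNitzan2024, §1 p. 2 (approach 1), §4 p. 25] [cite: BenjaminiSchramm1996, Conj. 4]
-/

noncomputable section

namespace Summit.CriticalPhenomena.PercolationContinuityZ3.Theorems.Transplant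

namespace SiteSameP

open MeasureTheory Literature.Probability.Percolation Literature.Probability.LatticeModels
open SiteStar (starRead top_adj_none_some)

/-- **INPUT (FSW)-site for `ℤ^d` at the origin** (the V18 socket of class C1a; a `Prop`, never asserted): at every density `p` with
`θ^{site}_{ℤ^d,0}(p) > 0` there is a history-driven scheme on the star `⊤ ⊇ K_{1,ℤ^d}` reading the vertex states, lawful at `(p, ε)` with
`ε < 2⁻³²`, with probe envelopes of at most `N` edges and `U₀ ⊆ E(⊤)`, whose infinite final macro-cluster forces `0 ↔^{site} ∞`.
[cite: KozmaNitzan2024, §4 p. 25 (Definition of an exploration process)] -/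
@[conjecture] def SiteSamePWitnessZd (d : ℕ) : Prop :=
  ∀ p : unitInterval, 0 < siteTheta (zdGraph d) (0 : Site d) p →
    ∃ (S : HSiteScheme (Option (Site d))) (ε : ℝ) (N : ℕ), S.Lawful (⊤ : SimpleGraph (Option (Site d))) p ε ∧ ε < (1 / 2) ^ 32 ∧
      (∀ hh P, S.E.next hh = some P → P.env.card ≤ N) ∧
      (↑S.U₀ : Set (Sym2 (Option (Site d)))) ⊆ (⊤ : SimpleGraph (Option (Site d))).edgeSet ∧
      S.initEvent ∩ {ω | (S.occFinal ω).Infinite} ⊆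
        starRead ⁻¹' sitePercolatesAt (zdGraph d) (0 : Site d) ∪ {ω | ¬ω ⊆ (⊤ : SimpleGraph (Option (Site d))).edgeSet}

/-- **The site same-`p` witness closes the site target on `ℤ^d`**: `SiteSamePWitnessZd d → θ^{site}_{ℤ^d}(p_c^{site}(ℤ^d)) = 0`
(site Theorem A at the origin, star carrier `⊤`). [cite: KozmaNitzan2024, §1 p. 2 (approach 1)] [cite: BenjaminiSchramm1996, Conj. 4] -/
theorem sitePercolationContinuity_of_siteSamePWitnessZd (d : ℕ) (h : SiteSamePWitnessZd d) : SitePercolationContinuity d := by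
  have key := siteTheta_criticalProb_eq_zero_of_schemes (zdGraph d) (G := (⊤ : SimpleGraph (Option (Site d))))
    top_adj_none_some (0 : Site d) h
  have e : (⟨siteCriticalProb (zdGraph d) (0 : Site d), siteCriticalProb_mem_Icc _ _⟩ : unitInterval) = siteCriticalProbI d := rfl
  rw [e] at key
  exact key

/-- **At `d = 3`: the lane's class-C1a target from the site witness.** [cite: BenjaminiSchramm1996, Conj. 4] -/
theorem sitePercolationContinuityZ3_of_siteSamePWitnessZd (h : SiteSamePWitnessZd 3) : SitePercolationContinuityZ3 :=
  sitePercolationContinuity_of_siteSamePWitnessZd 3 h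

end SiteSameP

end Summit.CriticalPhenomena.PercolationContinuityZ3.Theorems.Transplant
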